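import Summits.QuantumFields.YangMills.Theses.NoiseSynchronisation

/-!
# `TwoPointSynchronisation` — negative lemma, part I: multi-scale indicator patterns and the
# single-bit-flip averaging

Support file I (of three) for crux `stmt-QuantumFields-17976`
(`Summit.QuantumFields.YangMills.Theses.NoiseSynchronisation.TwoPointSynchronisation`); the negative lemma
itself is `TwoPointSynchronisationFalseOfSZZFlowSU2.lean` (part III), the abstract "no uniform exponential rate
for indicator observables without coalescence" lemma is `SlowSet.lean` (part II). Pure measure theory on `ℝ`,
tree/Mathlib objects only; nothing is posited; axioms `propext`, `Classical.choice`, `Quot.sound`.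

* `patternSet w B bits` — the points of a block `B ⊂ ℝ` whose cell `[jw, (j+1)w)` carries the bit `bits j`;
  `extBits`, `flipAt` — finite bit patterns on the cells meeting the block, extended by `false`, and the flip of
  one bit.
* `goodSet u v w B` — outcomes with `u ∈ B` and `v` not in the same cell of `B`; `disagreeSet u v w B F bits` — good
  outcomes on which membership of `u` and of `v` in `patternSet ∪ F` differ (`F` = the set already fixed on
  earlier blocks, disjoint from `B`).
* `mem_disagreeSet_flipAt` — flipping the bit of `u`'s cell toggles disagreement on every good outcome;
  `exists_pattern` — hence (summing over all patterns, `Fintype.sum_equiv` along the flip involution) SOME pattern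
  makes at least half of the good outcomes disagree, for any finite measure and any previously fixed `F`.
-/

set_option autoImplicit false

noncomputable section

open MeasureTheory Set Filter Topology ProbabilityTheory
open scoped ENNReal

namespace Summit.QuantumFields.YangMills.Theorems.TwoPointSynchronisation.Negative

/-- The points of the block `B` whose cell (of width `w`) carries the bit `true`. [folklore] -/
def patternSet (w : ℝ) (B : Set ℝ) (bits : ℤ → Bool) : Set ℝ :=
  B ∩ (fun x : ℝ => ⌊x / w⌋) ⁻¹' {j | bits j = true}

/-- The cell index `x ↦ ⌊x/w⌋` is measurable. [folklore] -/
theorem measurable_cell (w : ℝ) : Measurable (fun x : ℝ => ⌊x / w⌋) :=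
  Int.measurable_floor.comp (measurable_id.div_const w)

/-- Pattern sets of measurable blocks are measurable. [folklore] -/
theorem measurableSet_patternSet (w : ℝ) {B : Set ℝ} (hB : MeasurableSet B) (bits : ℤ → Bool) :
    MeasurableSet (patternSet w B bits) :=
  hB.inter ((measurable_cell w) (MeasurableSpace.measurableSet_top))

/-- Extension of a finite bit pattern by `false`. [folklore] -/
def extBits (J : Finset ℤ) (b : J → Bool) : ℤ → Bool :=
  fun j => if h : j ∈ J then b ⟨j, h⟩ else false

/-- `extBits` on `J` reads the pattern. [folklore] -/
theorem extBits_of_mem {J : Finset ℤ} (b : J → Bool) {j : ℤ} (h : j ∈ J) :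
    extBits J b j = b ⟨j, h⟩ := by
  simp [extBits, h]

/-- Flip the bit at `j`. [folklore] -/
def flipAt {J : Finset ℤ} (j : J) (b : J → Bool) : J → Bool :=
  Function.update b j (!b j)

/-- Flipping one bit is an involution. [folklore] -/
theorem flipAt_involutive {J : Finset ℤ} (j : J) : Function.Involutive (flipAt j) := by
  intro b
  funext i
  by_cases h : i = j
  · subst h; simp [flipAt]
  · simp [flipAt, Function.update_of_ne h]

/-- Flipping at `j` negates the bit read at `j`. [folklore] -/
theorem extBits_flipAt_self {J : Finset ℤ} (j : J) (b : J → Bool) :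
    extBits J (flipAt j b) j = !(extBits J b j) := by
  rw [extBits_of_mem _ j.2, extBits_of_mem _ j.2]
  simp [flipAt]

/-- Flipping at `j` does not change the bits read elsewhere. [folklore] -/
theorem extBits_flipAt_of_ne {J : Finset ℤ} (j : J) (b : J → Bool) {i : ℤ} (h : i ≠ j) :
    extBits J (flipAt j b) i = extBits J b i := by
  by_cases hi : i ∈ J
  · rw [extBits_of_mem _ hi, extBits_of_mem _ hi]
    have : (⟨i, hi⟩ : J) ≠ j := fun e => h (congrArg Subtype.val e)
    simp [flipAt, Function.update_of_ne this]
  · simp [extBits, hi]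

variable {Λ : Type*} [MeasurableSpace Λ]

/-- The good pairs of a block: `u ∈ B` and `v` is not in the same cell of `B`. [folklore] -/
def goodSet (u v : Λ → ℝ) (w : ℝ) (B : Set ℝ) : Set Λ :=
  {p | u p ∈ B ∧ ¬ (v p ∈ B ∧ ⌊v p / w⌋ = ⌊u p / w⌋)}

/-- Disagreement (on the good pairs) of membership in `patternSet ∪ F`. [folklore] -/
def disagreeSet (u v : Λ → ℝ) (w : ℝ) (B F : Set ℝ) (bits : ℤ → Bool) : Set Λ :=
  goodSet u v w B ∩ symmDiff (u ⁻¹' (patternSet w B bits ∪ F)) (v ⁻¹' (patternSet w B bits ∪ F))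

section Meas

variable {u v : Λ → ℝ} (hu : Measurable u) (hv : Measurable v)
include hu hv

omit hv in
/-- Cell slabs `{⌊u/w⌋ = j}` are measurable. [folklore] -/
theorem measurableSet_cellEq (w : ℝ) (j : ℤ) : MeasurableSet {p : Λ | ⌊u p / w⌋ = j} :=
  (measurable_cell w).comp hu (measurableSet_singleton j)

/-- The good set is measurable. [folklore] -/
theorem measurableSet_goodSet (w : ℝ) {B : Set ℝ} (hB : MeasurableSet B) :
    MeasurableSet (goodSet u v w B) := by
  have h1 : MeasurableSet {p : Λ | u p ∈ B} := hu hB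
  have h2 : MeasurableSet {p : Λ | v p ∈ B} := hv hB
  have h3 : MeasurableSet {p : Λ | ⌊v p / w⌋ = ⌊u p / w⌋} :=
    measurableSet_eq_fun ((measurable_cell w).comp hv) ((measurable_cell w).comp hu)
  exact h1.inter (h2.inter h3).compl

/-- The disagreement set is measurable. [folklore] -/
theorem measurableSet_disagreeSet (w : ℝ) {B F : Set ℝ} (hB : MeasurableSet B)
    (hF : MeasurableSet F) (bits : ℤ → Bool) : MeasurableSet (disagreeSet u v w B F bits) :=
  (measurableSet_goodSet hu hv w hB).inter
    ((hu ((measurableSet_patternSet w hB bits).union hF)).symmDiff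
      (hv ((measurableSet_patternSet w hB bits).union hF)))

end Meas

omit [MeasurableSpace Λ] in
/-- Pointwise effect of flipping the bit of `u`'s cell: on good pairs in cell `j`, disagreement toggles. [folklore] -/
theorem mem_disagreeSet_flipAt {u v : Λ → ℝ} {w : ℝ} {B F : Set ℝ} (hFB : Disjoint F B)
    {J : Finset ℤ} (j : J) (b : J → Bool) {p : Λ} (hp : p ∈ goodSet u v w B)
    (hj : ⌊u p / w⌋ = (j : ℤ)) :
    p ∈ disagreeSet u v w B F (extBits J (flipAt j b)) ↔ p ∉ disagreeSet u v w B F (extBits J b) := by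
  obtain ⟨huB, hvne⟩ := hp
  have huF : u p ∉ F := fun h => hFB.ne_of_mem h huB rfl
  -- membership of u
  have hu_mem : ∀ c : J → Bool, (u p ∈ patternSet w B (extBits J c) ∪ F) ↔ extBits J c j = true := by
    intro c
    simp only [patternSet, mem_union, mem_inter_iff, mem_preimage, mem_setOf_eq, hj]
    constructor
    · rintro (⟨-, h⟩ | h)
      · exact h
      · exact absurd h huF
    · intro h; exact Or.inl ⟨huB, h⟩
  -- membership of v does not change
  have hv_mem : (v p ∈ patternSet w B (extBits J (flipAt j b)) ∪ F) ↔
      (v p ∈ patternSet w B (extBits J b) ∪ F) := by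
    by_cases hvB : v p ∈ B
    · have hne : ⌊v p / w⌋ ≠ (j : ℤ) := fun h => hvne ⟨hvB, h.trans hj.symm⟩
      simp only [patternSet, mem_union, mem_inter_iff, mem_preimage, mem_setOf_eq,
        extBits_flipAt_of_ne j b hne]
    · simp only [patternSet, mem_union, mem_inter_iff, mem_preimage, mem_setOf_eq, hvB, false_and,
        false_or]
  have hgood : p ∈ goodSet u v w B := ⟨huB, hvne⟩
  simp only [disagreeSet, mem_inter_iff, hgood, true_and, mem_symmDiff, mem_preimage, hv_mem,
    hu_mem, extBits_flipAt_self]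
  cases extBits J b j
  · simp
  · simp
    tauto


variable {Λ : Type*} [MeasurableSpace Λ]

/-- **Averaging.** Some bit pattern makes at least half of the good pairs disagree. [folklore] -/
theorem exists_pattern (M : Measure Λ) [IsFiniteMeasure M] {u v : Λ → ℝ} (hu : Measurable u)
    (hv : Measurable v) (w : ℝ) {B F : Set ℝ} (hB : MeasurableSet B) (hF : MeasurableSet F)
    (hFB : Disjoint F B) (J : Finset ℤ) (hJ : ∀ x ∈ B, ⌊x / w⌋ ∈ J) :
    ∃ b : J → Bool, M.real (goodSet u v w B) ≤ 2 * M.real (disagreeSet u v w B F (extBits J b)) := by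
  classical
  set T := goodSet u v w B with hT
  let Tj : ℤ → Set Λ := fun j => T ∩ {p | ⌊u p / w⌋ = j}
  let A : (J → Bool) → Set Λ := fun b => disagreeSet u v w B F (extBits J b)
  have hTm : MeasurableSet T := measurableSet_goodSet hu hv w hB
  have hTjm : ∀ j, MeasurableSet (Tj j) := fun j => hTm.inter (measurableSet_cellEq hu w j)
  have hAm : ∀ b, MeasurableSet (A b) := fun b => measurableSet_disagreeSet hu hv w hB hF _
  -- per-cell identity
  have key : ∀ j ∈ J, ∑ b, 2 * M.real (A b ∩ Tj j) = ∑ _b : J → Bool, M.real (Tj j) := by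
    intro j hj
    let jj : J := ⟨j, hj⟩
    have hperm : ∑ b, M.real (A (flipAt jj b) ∩ Tj j) = ∑ b, M.real (A b ∩ Tj j) :=
      Fintype.sum_equiv (flipAt_involutive jj).toPerm _ _ (fun b => rfl)
    calc ∑ b, 2 * M.real (A b ∩ Tj j)
        = ∑ b, (M.real (A b ∩ Tj j) + M.real (A (flipAt jj b) ∩ Tj j)) := by
          rw [Finset.sum_add_distrib, hperm, ← Finset.mul_sum, two_mul]
      _ = ∑ _b, M.real (Tj j) := Finset.sum_congr rfl fun b _ => by
          have hdisj : Disjoint (A b ∩ Tj j) (A (flipAt jj b) ∩ Tj j) := by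
            rw [Set.disjoint_left]
            rintro p ⟨hpA, hpT⟩ ⟨hpA', -⟩
            exact ((mem_disagreeSet_flipAt hFB jj b hpT.1 hpT.2).1 hpA') hpA
          have hunion : A b ∩ Tj j ∪ A (flipAt jj b) ∩ Tj j = Tj j := by
            ext p
            constructor
            · rintro (⟨-, h⟩ | ⟨-, h⟩) <;> exact h
            · intro hpT
              by_cases hpA : p ∈ A b
              · exact Or.inl ⟨hpA, hpT⟩
              · exact Or.inr ⟨(mem_disagreeSet_flipAt hFB jj b hpT.1 hpT.2).2 hpA, hpT⟩
          rw [← measureReal_union hdisj ((hAm _).inter (hTjm j)), hunion]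
  -- T is the disjoint union of the Tj, j ∈ J
  have hdisjT : PairwiseDisjoint (↑J : Set ℤ) Tj := by
    intro i _ j _ hij
    rw [Function.onFun, Set.disjoint_left]
    rintro p ⟨-, hpi⟩ ⟨-, hpj⟩
    exact hij (hpi.symm.trans hpj)
  have hTunion : T = ⋃ j ∈ J, Tj j := by
    ext p
    simp only [mem_iUnion, exists_prop]
    constructor
    · intro hp; exact ⟨_, hJ _ hp.1, hp, rfl⟩
    · rintro ⟨j, -, hp, -⟩; exact hp
  have hTsum : M.real T = ∑ j ∈ J, M.real (Tj j) := by
    rw [hTunion]; exact measureReal_biUnion_finset hdisjT (fun j _ => hTjm j)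
  -- A b contains the disjoint union of the A b ∩ Tj j
  have hAsum : ∀ b, ∑ j ∈ J, M.real (A b ∩ Tj j) ≤ M.real (A b) := by
    intro b
    have hd : PairwiseDisjoint (↑J : Set ℤ) (fun j => A b ∩ Tj j) := by
      intro i hi j hj' hij
      exact (hdisjT hi hj' hij).mono inter_subset_right inter_subset_right
    rw [← measureReal_biUnion_finset hd (fun j _ => (hAm b).inter (hTjm j))]
    exact measureReal_mono (iUnion₂_subset fun j _ => inter_subset_left)
  -- sum over patterns
  have hsum : ∑ _b : J → Bool, M.real T ≤ ∑ b : J → Bool, 2 * M.real (A b) := by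
    calc ∑ _b : J → Bool, M.real T = ∑ _b : J → Bool, ∑ j ∈ J, M.real (Tj j) := by rw [hTsum]
      _ = ∑ j ∈ J, ∑ _b : J → Bool, M.real (Tj j) := Finset.sum_comm
      _ = ∑ j ∈ J, ∑ b : J → Bool, 2 * M.real (A b ∩ Tj j) :=
          Finset.sum_congr rfl fun j hj => (key j hj).symm
      _ = ∑ b : J → Bool, ∑ j ∈ J, 2 * M.real (A b ∩ Tj j) := Finset.sum_comm
      _ = ∑ b : J → Bool, 2 * ∑ j ∈ J, M.real (A b ∩ Tj j) :=
          Finset.sum_congr rfl fun b _ => (Finset.mul_sum _ _ _).symm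
      _ ≤ ∑ b : J → Bool, 2 * M.real (A b) :=
          Finset.sum_le_sum fun b _ => by linarith [hAsum b]
  obtain ⟨b, -, hb⟩ := Finset.exists_le_of_sum_le Finset.univ_nonempty hsum
  exact ⟨b, hb⟩

end Summit.QuantumFields.YangMills.Theorems.TwoPointSynchronisation.Negative

end
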